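import Mathlib
import Summits.Ventures.HodgeRepro2.T5MeasureSupOnClopens
import Summits.Ventures.HodgeRepro2.T5MuInvariantPadic
import Summits.Ventures.HodgeRepro2.T5AmiceTransform
import Summits.Ventures.HodgeRepro2.T5FiniteZerosUnion

/-!
# T5AmiceTwist — twisting a measure by a character, in the Amice dictionary

Cell pub-hodge-repro2, Tier 5 support (seat p7; route/T5-CHECK-G-p7.md §3 S4 / S6 / S7). §G twists the
measure by a continuous character («ν̃·m», S4: `∫φ d(ν̃·m) = ∫φν̃ dm`), evaluates twisted measures on
finite-order characters (S6: `∫ν d(λ̂⁻¹·L) = ∫νλ̂⁻¹ dL`), and bookkeeps the zero sets under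
`ν ↦ ν⁻¹` (S6 / S7: «replacing ν by ν⁻¹ … ν ∉ Z_i⁻¹»). On the cell's measure model
(T5MeasureSupOnClopens `twist ν m = m ∘ (ν · ·)`, T5AmiceTransform `amice`) this file records:

* `charCM_mul` / `charCM_inv`: continuous characters of `ℤ_p` multiply and invert as elements of
  `C(ℤ_p, R)` (the inverse is `κ⁻¹(x) = κ(−x)`, Mathlib's `AddChar` group structure);
* `twist_apply_char`: `(κ·m)(κ') = m(κκ')` — the twisted measure evaluated on a character is the measure
  on the product character;
* `aeval_amice_twist`: `f_{κ·m}(ζ' − 1) = f_m(ζζ' − 1)` for `ζ = κ 1`, `ζ' = κ' 1` — the twist is the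
  substitution `T ↦ ζ(1 + T) − 1` on evaluation points;
* `zeroSet_twist`: `Z(κ·m) = κ⁻¹ · Z(m)` (the killed characters of the twist are the translates), hence
  `ncard_zeroSet_twist`: `#Z(κ·m) = #Z(m)` — S7's `Z_i⁻¹` has the same size as `Z_i`;
* `twist_twist_inv`: `κ⁻¹·(κ·m) = m`; `twist_bound'` / `continuous_twist`: the twist of a bounded measure
  is bounded (integral `R`);
* `mu_twist_char`: on `R = ℤ_p`, `μ(κ·m) = μ(m)` with the inverse character exhibited
  (T5MuInvariantPadic's `mu_twist`) — S4's «μ(ν̃·m) = μ(m)» for a continuous character `ν̃`.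

Mathlib + own T5MeasureSupOnClopens, T5MuInvariantPadic, T5AmiceTransform, T5FiniteZerosUnion (its `zeroSet`) only.
-/

namespace Summit.Ventures.HodgeRepro2.T5AmiceTwist

open PadicInt Filter Topology
open Summit.Ventures.HodgeRepro2
open Summit.Ventures.HodgeRepro2.T5MeasureSupOnClopens
open Summit.Ventures.HodgeRepro2.T5AmiceTransform

variable {p : ℕ} [hp : Fact p.Prime]

section Characters

variable {R : Type*} [NormedCommRing R]

/-- A continuous character of `ℤ_p`, as an element of `C(ℤ_p, R)`. -/
noncomputable def charCM (κ : AddChar ℤ_[p] R) (hκ : Continuous κ) : C(ℤ_[p], R) := ⟨κ, hκ⟩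

/-- `charCM κ hκ x = κ x`. -/
@[simp] theorem charCM_apply (κ : AddChar ℤ_[p] R) (hκ : Continuous κ) (x : ℤ_[p]) :
    charCM κ hκ x = κ x := rfl

/-- The inverse character `κ⁻¹(x) = κ(−x)` is continuous. -/
theorem continuous_inv (κ : AddChar ℤ_[p] R) (hκ : Continuous κ) : Continuous (κ⁻¹ : AddChar ℤ_[p] R) := by
  have : ⇑(κ⁻¹ : AddChar ℤ_[p] R) = fun x => κ (-x) := funext fun x => AddChar.inv_apply κ x
  rw [this]
  exact hκ.comp continuous_neg

/-- Products of continuous characters are continuous. -/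
theorem continuous_mul (κ κ' : AddChar ℤ_[p] R) (hκ : Continuous κ) (hκ' : Continuous κ') :
    Continuous (κ * κ') := by
  have : ⇑(κ * κ') = fun x => κ x * κ' x := funext fun x => AddChar.mul_apply κ κ' x
  rw [this]
  exact hκ.mul hκ'

/-- `charCM (κ κ') = charCM κ * charCM κ'`. -/
theorem charCM_mul (κ κ' : AddChar ℤ_[p] R) (hκ : Continuous κ) (hκ' : Continuous κ') :
    charCM (κ * κ') (continuous_mul κ κ' hκ hκ') = charCM κ hκ * charCM κ' hκ' := by
  ext x
  simp [charCM]

/-- `charCM κ⁻¹ * charCM κ = 1` in `C(ℤ_p, R)`. -/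
theorem charCM_inv_mul (κ : AddChar ℤ_[p] R) (hκ : Continuous κ) :
    charCM κ⁻¹ (continuous_inv κ hκ) * charCM κ hκ = 1 := by
  ext x
  simp only [ContinuousMap.mul_apply, charCM_apply, ContinuousMap.one_apply, AddChar.inv_apply]
  rw [← AddChar.map_add_eq_mul, neg_add_cancel, AddChar.map_zero_eq_one]

/-- `charCM κ * charCM κ⁻¹ = 1` in `C(ℤ_p, R)`. -/
theorem charCM_mul_inv (κ : AddChar ℤ_[p] R) (hκ : Continuous κ) :
    charCM κ hκ * charCM κ⁻¹ (continuous_inv κ hκ) = 1 := by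
  rw [mul_comm]
  exact charCM_inv_mul κ hκ

/-- `charCM 1 = 1`. -/
theorem charCM_one : charCM (1 : AddChar ℤ_[p] R) continuous_const = 1 := by
  ext x
  simp [charCM]

/-- The evaluation point of the product character is `ζζ' − 1 = ζ(1 + (ζ' − 1)) − 1`: the substitution
`T ↦ ζ(1 + T) − 1`. -/
theorem mul_eval_one_sub_one (κ κ' : AddChar ℤ_[p] R) :
    (κ * κ') 1 - 1 = κ 1 * (1 + (κ' 1 - 1)) - 1 := by
  rw [AddChar.mul_apply, add_sub_cancel]

end Characters

section Twist

variable {R : Type*} [NormedCommRing R]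

/-- `(κ·m)(κ') = m(κκ')`: the twisted measure on a character is the measure on the product character
(S6's `∫ν d(λ̂⁻¹·L) = ∫νλ̂⁻¹ dL`). -/
theorem twist_apply_char (m : C(ℤ_[p], R) →ₗ[R] R) (κ κ' : AddChar ℤ_[p] R) (hκ : Continuous κ)
    (hκ' : Continuous κ') :
    twist (charCM κ hκ) m (charCM κ' hκ') = m (charCM (κ * κ') (continuous_mul κ κ' hκ hκ')) := by
  rw [twist_apply, charCM_mul]

/-- `κ⁻¹·(κ·m) = m`. -/
theorem twist_inv_twist (m : C(ℤ_[p], R) →ₗ[R] R) (κ : AddChar ℤ_[p] R) (hκ : Continuous κ) :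
    twist (charCM κ⁻¹ (continuous_inv κ hκ)) (twist (charCM κ hκ) m) = m := by
  ext φ
  rw [twist_apply, twist_apply, ← mul_assoc, charCM_mul_inv, one_mul]

/-- `κ·(κ⁻¹·m) = m`. -/
theorem twist_twist_inv (m : C(ℤ_[p], R) →ₗ[R] R) (κ : AddChar ℤ_[p] R) (hκ : Continuous κ) :
    twist (charCM κ hκ) (twist (charCM κ⁻¹ (continuous_inv κ hκ)) m) = m := by
  ext φ
  rw [twist_apply, twist_apply, ← mul_assoc, charCM_inv_mul, one_mul]

/-- The twist of a bounded measure by any `ν ∈ C(ℤ_p, R)` is bounded with the same constant, for an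
integral `R` (`‖r‖ ≤ 1`). -/
theorem twist_bound' (hR : ∀ r : R, ‖r‖ ≤ 1) (ν : C(ℤ_[p], R)) (m : C(ℤ_[p], R) →ₗ[R] R) {C : ℝ}
    (hC : 0 ≤ C) (hb : ∀ φ, ‖m φ‖ ≤ C * ‖φ‖) (φ : C(ℤ_[p], R)) : ‖twist ν m φ‖ ≤ C * ‖φ‖ :=
  twist_bound hR ν m hC hb φ

/-- The twist of a bounded measure is continuous (integral `R`). -/
theorem continuous_twist (hR : ∀ r : R, ‖r‖ ≤ 1) (ν : C(ℤ_[p], R)) (m : C(ℤ_[p], R) →ₗ[R] R) {C : ℝ}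
    (hC : 0 ≤ C) (hb : ∀ φ, ‖m φ‖ ≤ C * ‖φ‖) : Continuous (twist ν m) :=
  continuous_of_bound _ C (twist_bound' hR ν m hC hb)

/-- `(κ·m)(κ') = 0 ⟺ m(κκ') = 0`. -/
theorem twist_char_eq_zero_iff (m : C(ℤ_[p], R) →ₗ[R] R) (κ κ' : AddChar ℤ_[p] R) (hκ : Continuous κ)
    (hκ' : Continuous κ') :
    twist (charCM κ hκ) m (charCM κ' hκ') = 0 ↔
      m (charCM (κ * κ') (continuous_mul κ κ' hκ hκ')) = 0 := by
  rw [twist_apply_char]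

end Twist

section Coefficients

variable {R : Type*} [NormedCommRing R] [Algebra ℤ_[p] R] [IsBoundedSMul ℤ_[p] R]

/-- The coefficients of `f_{ν·m}` are the twisted moments `m(ν · (x choose n))`. -/
theorem coeff_amice_twist (ν : C(ℤ_[p], R)) (m : C(ℤ_[p], R) →ₗ[R] R) (n : ℕ) :
    PowerSeries.coeff n (amice (twist ν m)) = m (ν * mahlerTerm (1 : R) n) := by
  rw [coeff_amice, twist_apply]

end Coefficients

section Evaluation

variable {R : Type*} [NormedCommRing R] [Algebra ℤ_[p] R] [IsBoundedSMul ℤ_[p] R]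
  [IsUltrametricDist R] [CompleteSpace R] [IsLinearTopology R R]

/-- THE TWIST IS A SUBSTITUTION ON EVALUATION POINTS: `f_{κ·m}(ζ' − 1) = f_m(ζζ' − 1)` with `ζ = κ 1`,
`ζ' = κ' 1` (both sides equal `m(κκ')`). -/
theorem aeval_amice_twist (m : C(ℤ_[p], R) →ₗ[R] R) (hm : Continuous m) (κ κ' : AddChar ℤ_[p] R)
    (hκ : Continuous κ) (hκ' : Continuous κ') (ht : Continuous (twist (charCM κ hκ) m)) :
    PowerSeries.aeval (hasEval_eval_one_sub_one κ' hκ') (amice (twist (charCM κ hκ) m)) =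
      PowerSeries.aeval (hasEval_eval_one_sub_one (κ * κ') (continuous_mul κ κ' hκ hκ')) (amice m) := by
  rw [aeval_amice_eq_map _ ht κ' hκ', aeval_amice_eq_map m hm (κ * κ') (continuous_mul κ κ' hκ hκ')]
  exact twist_apply_char m κ κ' hκ hκ'

end Evaluation

section ZeroSets

open Summit.Ventures.HodgeRepro2.T5FiniteZerosUnion

variable {R : Type*} [NormedCommRing R]

/-- Membership in T5FiniteZerosUnion's `zeroSet m = Z(m) = {κ' continuous : m κ' = 0}`, in the `charCM`
vocabulary. -/
theorem mem_zeroSet_iff (m : C(ℤ_[p], R) →ₗ[R] R) (κ : {κ : AddChar ℤ_[p] R // Continuous κ}) :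
    κ ∈ zeroSet m ↔ m (charCM κ.1 κ.2) = 0 := Iff.rfl

/-- Translation of continuous characters by `κ`: `κ' ↦ κκ'`, an equivalence with inverse `κ' ↦ κ⁻¹κ'`. -/
noncomputable def translateEquiv (κ : AddChar ℤ_[p] R) (hκ : Continuous κ) :
    {κ' : AddChar ℤ_[p] R // Continuous κ'} ≃ {κ' : AddChar ℤ_[p] R // Continuous κ'} where
  toFun κ' := ⟨κ * κ'.1, continuous_mul κ κ'.1 hκ κ'.2⟩
  invFun κ' := ⟨κ⁻¹ * κ'.1, continuous_mul κ⁻¹ κ'.1 (continuous_inv κ hκ) κ'.2⟩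
  left_inv κ' := by
    ext1
    simp only [← mul_assoc, inv_mul_cancel, one_mul]
  right_inv κ' := by
    ext1
    simp only [← mul_assoc, mul_inv_cancel, one_mul]

/-- `(translateEquiv κ hκ κ').1 = κ * κ'.1`. -/
@[simp] theorem translateEquiv_apply (κ : AddChar ℤ_[p] R) (hκ : Continuous κ)
    (κ' : {κ' : AddChar ℤ_[p] R // Continuous κ'}) : (translateEquiv κ hκ κ').1 = κ * κ'.1 := rfl

/-- `Z(κ·m) = (κ · ·)⁻¹ Z(m)`: the characters killed by the twist are exactly the `κ'` with `κκ' ∈ Z(m)`,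
i.e. `Z(κ·m) = κ⁻¹ · Z(m)` (S6 / S7's «ν ∉ Z_i⁻¹» bookkeeping). -/
theorem zeroSet_twist (m : C(ℤ_[p], R) →ₗ[R] R) (κ : AddChar ℤ_[p] R) (hκ : Continuous κ) :
    zeroSet (twist (charCM κ hκ) m) = translateEquiv κ hκ ⁻¹' zeroSet m := by
  ext κ'
  rw [Set.mem_preimage, mem_zeroSet_iff, mem_zeroSet_iff]
  exact twist_char_eq_zero_iff m κ κ'.1 hκ κ'.2

/-- `#Z(κ·m) = #Z(m)`: twisting does not change the number of killed characters (S7's `|Z_i⁻¹| = |Z_i|`). -/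
theorem ncard_zeroSet_twist (m : C(ℤ_[p], R) →ₗ[R] R) (κ : AddChar ℤ_[p] R) (hκ : Continuous κ) :
    (zeroSet (twist (charCM κ hκ) m)).ncard = (zeroSet m).ncard := by
  rw [zeroSet_twist]
  exact Set.ncard_preimage_of_injective_subset_range (translateEquiv κ hκ).injective
    (by rw [(translateEquiv κ hκ).range_eq_univ]; exact Set.subset_univ _)

/-- `Z(κ·m)` is finite iff `Z(m)` is. -/
theorem finite_zeroSet_twist_iff (m : C(ℤ_[p], R) →ₗ[R] R) (κ : AddChar ℤ_[p] R) (hκ : Continuous κ) :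
    (zeroSet (twist (charCM κ hκ) m)).Finite ↔ (zeroSet m).Finite := by
  rw [zeroSet_twist]
  constructor
  · intro h
    have := h.image (translateEquiv κ hκ)
    rwa [Set.image_preimage_eq _ (translateEquiv κ hκ).surjective] at this
  · intro h
    exact h.preimage (translateEquiv κ hκ).injective.injOn

end ZeroSets

section MuInvariant

open Summit.Ventures.HodgeRepro2.T5MuInvariantPadic

/-- S4's «μ(ν̃·m) = μ(m)» for a continuous character `ν̃ = κ` of `ℤ_p` with values in `ℤ_p`: the inverse
character `κ⁻¹` supplies the `ν' ` of T5MuInvariantPadic's `mu_twist`. -/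
theorem mu_twist_char (m : C(ℤ_[p], ℤ_[p]) →ₗ[ℤ_[p]] ℤ_[p]) {C : ℝ} (hC : 0 ≤ C)
    (hb : ∀ φ, ‖m φ‖ ≤ C * ‖φ‖) (κ : AddChar ℤ_[p] ℤ_[p]) (hκ : Continuous κ) :
    mu p (twist (charCM κ hκ) m) = mu p m :=
  mu_twist p (charCM κ hκ) (charCM κ⁻¹ (continuous_inv κ hκ)) (charCM_mul_inv κ hκ) m hC hb

end MuInvariant

end Summit.Ventures.HodgeRepro2.T5AmiceTwist
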